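import Mathlib
import HarnessLib

/-!
# Vinogradov's mean value theorem, I: the counting function `J_{k,n}` (Ivić §6.2, (6.9)–(6.16))

Topic `Literature/NumberTheory/LFunctions`. Everything in this file is PROVED (no named facts).

For integers `n ≥ 0` (degree), `k ≥ 0` (number of variables on each side) and a finite set `I ⊂ ℤ`
of admissible values (Ivić: `I = [1, P]`), `J_{k,n}(I; λ)` is the number of solutions of the system

  `x₁^j + ⋯ + x_k^j − y₁^j − ⋯ − y_k^j = λ_j`   (`1 ≤ j ≤ n`),   `x_i, y_i ∈ I`

(Ivić (6.9)), and `J_{k,n}(I) = J_{k,n}(I; 0)` (Ivić (6.5), in its arithmetic form).  We prove the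
elementary facts of Ivić §6.2 preceding Lemma 6.1:

* `Jc_le_J` — (6.10): `J_{k,n}(I; λ) ≤ J_{k,n}(I)` (here by Cauchy–Schwarz on the representation
  numbers instead of the integral (6.8));
* `sum_Jc_eq` — (6.11): `∑_λ J_{k,n}(I; λ) = |I|^{2k}`;
* `J_translate`, `J_dilate` — invariance of `J_{k,n}(I)` under `I ↦ I + c` and `I ↦ pI` (the
  binomial theorem; used in the proof of Lemma 6.2: "the number of solutions … does not change if
  `x` is subtracted from the unknowns");
* `Jc_mono` — monotonicity in `I`;
* `J_add_le` — (6.32): `J_{k₁+k₂,n}(I) ≤ |I|^{2k₁} J_{k₂,n}(I)`.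

## References

* A. Ivić, *The Riemann Zeta-Function*, Wiley 1985, §6.2, (6.9)–(6.16), (6.32).
-/

open Finset

namespace Literature.NumberTheory.LFunctions
namespace VMV

/-! ### Power-sum vectors and the counting function -/

/-- The power-sum vector `s(x) = (∑_i x_i^j)_{j=1,…,n}` of a tuple `x ∈ ℤ^k` (index `j : Fin n`
stands for the exponent `j+1`). [cite: Ivic1985, (6.9)] -/
def psv (n : ℕ) {k : ℕ} (x : Fin k → ℤ) : Fin n → ℤ := fun j => ∑ i, x i ^ (j.val + 1)

/-- The box `I^k` of tuples with entries in the finite set `I ⊂ ℤ`. [folklore] -/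
def tuples (k : ℕ) (I : Finset ℤ) : Finset (Fin k → ℤ) := Fintype.piFinset fun _ => I

/-- `J_{k,n}(I; λ)`: the number of pairs `(x, y) ∈ I^k × I^k` with `s(x) = s(y) + λ`, i.e. of
solutions of `∑ x_i^j − ∑ y_i^j = λ_j` (`1 ≤ j ≤ n`). [cite: Ivic1985, (6.9)] -/
def Jc (n k : ℕ) (I : Finset ℤ) (lam : Fin n → ℤ) : ℕ :=
  ((tuples k I ×ˢ tuples k I).filter (fun xy => psv n xy.1 = psv n xy.2 + lam)).card

/-- `J_{k,n}(I) = J_{k,n}(I; 0)`, Vinogradov's mean value as a number of solutions.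
[cite: Ivic1985, (6.5) and (6.9)] -/
def J (n k : ℕ) (I : Finset ℤ) : ℕ := Jc n k I 0

/-- The representation number `r(μ) = #{x ∈ I^k : s(x) = μ}`. [folklore] -/
def rep (n k : ℕ) (I : Finset ℤ) (μ : Fin n → ℤ) : ℕ :=
  ((tuples k I).filter (fun x => psv n x = μ)).card

/-- Auxiliary (theorem `mem_tuples`). [folklore] -/
theorem mem_tuples {k : ℕ} {I : Finset ℤ} {x : Fin k → ℤ} : x ∈ tuples k I ↔ ∀ i, x i ∈ I := by
  simp [tuples, Fintype.mem_piFinset]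

/-- Auxiliary (theorem `card_tuples`). [folklore] -/
theorem card_tuples (k : ℕ) (I : Finset ℤ) : (tuples k I).card = I.card ^ k := by
  simp [tuples, Fintype.card_piFinset]

/-! ### `J` through representation numbers; (6.10) and (6.11) -/

/-- `J_{k,n}(I; λ) = ∑_{y ∈ I^k} r(s(y) + λ)`. [folklore] -/
theorem Jc_eq_sum_rep (n k : ℕ) (I : Finset ℤ) (lam : Fin n → ℤ) :
    Jc n k I lam = ∑ y ∈ tuples k I, rep n k I (psv n y + lam) := by
  unfold Jc rep
  rw [card_filter, sum_product_right]
  refine sum_congr rfl fun y _ => ?_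
  rw [card_filter]

/-- `J_{k,n}(I; λ) = ∑_{μ} r(μ + λ) r(μ)`, the sum over the values `μ = s(y)`. [folklore] -/
theorem Jc_eq_sum_rep_mul (n k : ℕ) (I : Finset ℤ) (lam : Fin n → ℤ) :
    Jc n k I lam =
      ∑ μ ∈ (tuples k I).image (psv n), rep n k I (μ + lam) * rep n k I μ := by
  classical
  rw [Jc_eq_sum_rep]
  rw [Finset.sum_comp (s := tuples k I) (f := fun μ => rep n k I (μ + lam)) (g := psv n)]
  refine sum_congr rfl fun μ _ => ?_
  rw [smul_eq_mul, mul_comm]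
  rfl

/-- `r(ν) = 0` unless `ν` is a value `s(x)`, `x ∈ I^k`. [folklore] -/
theorem rep_eq_zero_of_not_mem {n k : ℕ} {I : Finset ℤ} {ν : Fin n → ℤ}
    (h : ν ∉ (tuples k I).image (psv n)) : rep n k I ν = 0 := by
  unfold rep
  rw [card_eq_zero, filter_eq_empty_iff]
  intro x hx hx'
  exact h (mem_image.2 ⟨x, hx, hx'⟩)

/-- **Ivić (6.10)**: `J_{k,n}(I; λ) ≤ J_{k,n}(I)` — by Cauchy–Schwarz (`2ab ≤ a² + b²`) on
`J(λ) = ∑_μ r(μ+λ) r(μ)`, `J(0) = ∑_μ r(μ)²`. [cite: Ivic1985, (6.10)] -/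
theorem Jc_le_J (n k : ℕ) (I : Finset ℤ) (lam : Fin n → ℤ) : Jc n k I lam ≤ J n k I := by
  classical
  set M := (tuples k I).image (psv n) with hM
  have h0 : J n k I = ∑ μ ∈ M, rep n k I μ * rep n k I μ := by
    unfold J; rw [Jc_eq_sum_rep_mul]; simp [hM]
  have h1 : Jc n k I lam = ∑ μ ∈ M, rep n k I (μ + lam) * rep n k I μ := Jc_eq_sum_rep_mul ..
  -- shifted squares are dominated by unshifted squares
  have hshift : ∑ μ ∈ M, rep n k I (μ + lam) * rep n k I (μ + lam) ≤
      ∑ μ ∈ M, rep n k I μ * rep n k I μ := by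
    have hinj : Set.InjOn (fun μ : Fin n → ℤ => μ + lam) (M : Set (Fin n → ℤ)) :=
      fun a _ b _ h => by simpa using h
    rw [← sum_image (f := fun ν => rep n k I ν * rep n k I ν) hinj]
    refine sum_le_sum_of_ne_zero fun ν _ hne => ?_
    by_contra hνM
    rw [rep_eq_zero_of_not_mem (by rw [← hM]; exact hνM), zero_mul] at hne
    exact hne rfl
  -- 2 r(μ+λ) r(μ) ≤ r(μ+λ)² + r(μ)²
  have hkey : 2 * Jc n k I lam ≤ 2 * J n k I := by
    rw [h1, h0, mul_sum, mul_sum]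
    calc ∑ μ ∈ M, 2 * (rep n k I (μ + lam) * rep n k I μ)
        ≤ ∑ μ ∈ M, (rep n k I (μ + lam) * rep n k I (μ + lam) + rep n k I μ * rep n k I μ) := by
          refine sum_le_sum fun μ _ => ?_
          nlinarith [sq_nonneg ((rep n k I (μ + lam) : ℤ) - rep n k I μ)]
      _ = ∑ μ ∈ M, rep n k I (μ + lam) * rep n k I (μ + lam) +
            ∑ μ ∈ M, rep n k I μ * rep n k I μ := sum_add_distrib
      _ ≤ ∑ μ ∈ M, rep n k I μ * rep n k I μ + ∑ μ ∈ M, rep n k I μ * rep n k I μ :=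
          Nat.add_le_add_right hshift _
      _ = ∑ μ ∈ M, 2 * (rep n k I μ * rep n k I μ) := by rw [← two_mul, mul_sum]
  omega

/-- **Ivić (6.11)**: `∑_λ J_{k,n}(I; λ) = |I|^{2k}`, the sum over any finite set of `λ`
containing all differences `s(x) − s(y)`. [cite: Ivic1985, (6.11)] -/
theorem sum_Jc_eq (n k : ℕ) (I : Finset ℤ) {Λ : Finset (Fin n → ℤ)}
    (hΛ : ∀ x ∈ tuples k I, ∀ y ∈ tuples k I, psv n x - psv n y ∈ Λ) :
    ∑ lam ∈ Λ, Jc n k I lam = I.card ^ (2 * k) := by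
  classical
  have h := card_eq_sum_card_fiberwise
    (f := fun xy : (Fin k → ℤ) × (Fin k → ℤ) => psv n xy.1 - psv n xy.2)
    (s := tuples k I ×ˢ tuples k I) (t := Λ) (by
      intro xy hxy
      rw [Finset.mem_coe, mem_product] at hxy
      exact hΛ _ hxy.1 _ hxy.2)
  rw [card_product, card_tuples] at h
  rw [show I.card ^ (2 * k) = I.card ^ k * I.card ^ k by ring, h]
  refine sum_congr rfl fun lam _ => ?_
  unfold Jc
  congr 1
  refine filter_congr fun xy _ => ?_
  constructor
  · intro h1; rw [h1]; abel
  · intro h1; rw [← h1]; abel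

/-! ### Monotonicity and invariances -/

/-- Monotonicity of `J_{k,n}(I; λ)` in `I`. [folklore] -/
theorem Jc_mono (n k : ℕ) {I I' : Finset ℤ} (h : I ⊆ I') (lam : Fin n → ℤ) :
    Jc n k I lam ≤ Jc n k I' lam := by
  unfold Jc
  refine card_le_card (filter_subset_filter _ (product_subset_product ?_ ?_)) <;>
    exact Fintype.piFinset_subset _ _ fun _ => h

/-- Power sums of a translated tuple are determined by those of the tuple (binomial theorem):
if `s(x) = s(y)` then `s(x + c) = s(y + c)`. [folklore] -/
theorem psv_add_const_eq {n k : ℕ} {x y : Fin k → ℤ} (h : psv n x = psv n y) (c : ℤ) :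
    psv n (fun i => x i + c) = psv n (fun i => y i + c) := by
  -- all power sums of exponent `l ≤ n` agree (exponent `0` trivially)
  have hl : ∀ l : ℕ, l ≤ n → ∑ i, x i ^ l = ∑ i, y i ^ l := by
    intro l hl
    rcases l with _ | l
    · simp
    · exact congr_fun h ⟨l, by omega⟩
  funext j
  simp only [psv]
  have hx : ∀ z : Fin k → ℤ, ∑ i, (z i + c) ^ (j.val + 1) =
      ∑ m ∈ range (j.val + 1 + 1), (∑ i, z i ^ m) * (c ^ (j.val + 1 - m) * ((j.val + 1).choose m : ℤ)) := by
    intro z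
    simp_rw [add_pow]
    rw [sum_comm]
    refine sum_congr rfl fun m _ => ?_
    rw [sum_mul]
    exact sum_congr rfl fun i _ => by ring
  rw [hx x, hx y]
  refine sum_congr rfl fun m hm => ?_
  rw [hl m (by have := j.isLt; rw [mem_range] at hm; omega)]

/-- **Translation invariance**: `J_{k,n}(I + c) = J_{k,n}(I)` ("the number of solutions … does not
change if `x` is subtracted from the unknowns"). [cite: Ivic1985, proof of Lemma 6.2] -/
theorem J_translate (n k : ℕ) (I : Finset ℤ) (c : ℤ) : J n k (I.image (· + c)) = J n k I := by
  classical
  unfold J Jc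
  symm
  refine card_nbij' (fun xy => (fun i => xy.1 i + c, fun i => xy.2 i + c))
    (fun xy => (fun i => xy.1 i - c, fun i => xy.2 i - c)) ?_ ?_ ?_ ?_
  · intro xy hxy
    rw [mem_coe, mem_filter, mem_product, mem_tuples, mem_tuples] at hxy ⊢
    refine ⟨⟨fun i => mem_image.2 ⟨_, hxy.1.1 i, rfl⟩, fun i => mem_image.2 ⟨_, hxy.1.2 i, rfl⟩⟩, ?_⟩
    rw [add_zero] at hxy ⊢
    exact psv_add_const_eq hxy.2 c
  · intro xy hxy
    rw [mem_coe, mem_filter, mem_product, mem_tuples, mem_tuples] at hxy ⊢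
    refine ⟨⟨fun i => ?_, fun i => ?_⟩, ?_⟩
    · obtain ⟨a, ha, hai⟩ := mem_image.1 (hxy.1.1 i); simp only [← hai, add_sub_cancel_right]; exact ha
    · obtain ⟨a, ha, hai⟩ := mem_image.1 (hxy.1.2 i); simp only [← hai, add_sub_cancel_right]; exact ha
    · rw [add_zero] at hxy ⊢
      simpa only [sub_eq_add_neg] using psv_add_const_eq hxy.2 (-c)
  · intro xy _; ext i <;> simp
  · intro xy _; ext i <;> simp

/-- Power sums of a dilated tuple: `s(px)_j = p^j s(x)_j`. [folklore] -/
theorem psv_const_mul {n k : ℕ} (x : Fin k → ℤ) (p : ℤ) (j : Fin n) :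
    psv n (fun i => p * x i) j = p ^ (j.val + 1) * psv n x j := by
  simp only [psv, mul_pow, mul_sum]

/-- **Dilation invariance**: `J_{k,n}(pI) = J_{k,n}(I)` for `p ≠ 0`. [folklore] -/
theorem J_dilate (n k : ℕ) (I : Finset ℤ) {p : ℤ} (hp : p ≠ 0) : J n k (I.image (p * ·)) = J n k I := by
  classical
  unfold J Jc
  symm
  refine card_nbij' (fun xy => (fun i => p * xy.1 i, fun i => p * xy.2 i))
    (fun xy => (fun i => xy.1 i / p, fun i => xy.2 i / p)) ?_ ?_ ?_ ?_
  · intro xy hxy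
    rw [mem_coe, mem_filter, mem_product, mem_tuples, mem_tuples] at hxy ⊢
    refine ⟨⟨fun i => mem_image.2 ⟨_, hxy.1.1 i, rfl⟩, fun i => mem_image.2 ⟨_, hxy.1.2 i, rfl⟩⟩, ?_⟩
    rw [add_zero] at hxy ⊢
    funext j
    rw [psv_const_mul, psv_const_mul, hxy.2]
  · intro xy hxy
    rw [mem_coe, mem_filter, mem_product, mem_tuples, mem_tuples] at hxy ⊢
    have h1 : ∀ i, ∃ a ∈ I, xy.1 i = p * a := fun i => by
      obtain ⟨a, ha, hai⟩ := mem_image.1 (hxy.1.1 i); exact ⟨a, ha, hai.symm⟩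
    have h2 : ∀ i, ∃ a ∈ I, xy.2 i = p * a := fun i => by
      obtain ⟨a, ha, hai⟩ := mem_image.1 (hxy.1.2 i); exact ⟨a, ha, hai.symm⟩
    choose a ha hxa using h1
    choose b hb hxb using h2
    have hxa' : ∀ i, xy.1 i / p = a i := fun i => by rw [hxa i, Int.mul_ediv_cancel_left _ hp]
    have hxb' : ∀ i, xy.2 i / p = b i := fun i => by rw [hxb i, Int.mul_ediv_cancel_left _ hp]
    dsimp only
    refine ⟨⟨fun i => by rw [hxa']; exact ha i, fun i => by rw [hxb']; exact hb i⟩, ?_⟩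
    rw [show (fun i => xy.1 i / p) = a from funext hxa', show (fun i => xy.2 i / p) = b from funext hxb']
    rw [add_zero] at hxy ⊢
    have hx1 : xy.1 = fun i => p * a i := funext hxa
    have hx2 : xy.2 = fun i => p * b i := funext hxb
    have key := hxy.2
    rw [hx1, hx2] at key
    funext j
    have := congr_fun key j
    rw [psv_const_mul, psv_const_mul] at this
    exact mul_left_cancel₀ (pow_ne_zero _ hp) this
  · intro xy hxy
    ext i <;> simp [Int.mul_ediv_cancel_left _ hp]
  · intro xy hxy
    rw [mem_coe, mem_filter, mem_product, mem_tuples, mem_tuples] at hxy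
    ext i
    · obtain ⟨a, _, hai⟩ := mem_image.1 (hxy.1.1 i)
      simp only [← hai, Int.mul_ediv_cancel_left _ hp]
    · obtain ⟨a, _, hai⟩ := mem_image.1 (hxy.1.2 i)
      simp only [← hai, Int.mul_ediv_cancel_left _ hp]

/-! ### Splitting the variables: `J_{a+b,n}` in product form and (6.32) -/

/-- Power sums are additive under concatenation of tuples. [folklore] -/
theorem psv_append {n a b : ℕ} (u : Fin a → ℤ) (z : Fin b → ℤ) :
    psv n (Fin.append u z) = psv n u + psv n z := by
  funext j
  simp only [psv, Pi.add_apply]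
  rw [Fin.sum_univ_add]
  simp only [Fin.append_left, Fin.append_right]

/-- `J_{a+b,n}(I)` in product coordinates: the number of `((u,z),(u',z')) ∈ (I^a × I^b)²` with
`s(u) + s(z) = s(u') + s(z')`. [folklore] -/
theorem J_add_eq_card (n a b : ℕ) (I : Finset ℤ) :
    J n (a + b) I = (((tuples a I ×ˢ tuples b I) ×ˢ (tuples a I ×ˢ tuples b I)).filter
      (fun w => psv n w.1.1 + psv n w.1.2 = psv n w.2.1 + psv n w.2.2)).card := by
  classical
  unfold J Jc
  refine card_nbij' (fun xy => ((Fin.appendEquiv a b).symm xy.1, (Fin.appendEquiv a b).symm xy.2))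
    (fun w => (Fin.appendEquiv a b w.1, Fin.appendEquiv a b w.2)) ?_ ?_ ?_ ?_
  · intro xy hxy
    rw [mem_coe, mem_filter, mem_product, mem_tuples, mem_tuples] at hxy
    rw [mem_coe, mem_filter, mem_product, mem_product, mem_product, mem_tuples, mem_tuples, mem_tuples,
      mem_tuples]
    simp only [Fin.appendEquiv_symm_apply]
    refine ⟨⟨⟨fun i => hxy.1.1 _, fun i => hxy.1.1 _⟩, fun i => hxy.1.2 _, fun i => hxy.1.2 _⟩, ?_⟩
    have h1 : xy.1 = Fin.append (fun i => xy.1 (Fin.castAdd b i)) (fun i => xy.1 (Fin.natAdd a i)) := by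
      ext i; refine Fin.addCases (fun i => ?_) (fun i => ?_) i <;> simp
    have h2 : xy.2 = Fin.append (fun i => xy.2 (Fin.castAdd b i)) (fun i => xy.2 (Fin.natAdd a i)) := by
      ext i; refine Fin.addCases (fun i => ?_) (fun i => ?_) i <;> simp
    have key := hxy.2
    rw [add_zero, h1, h2, psv_append, psv_append] at key
    exact key
  · intro w hw
    rw [mem_coe, mem_filter, mem_product, mem_product, mem_product, mem_tuples, mem_tuples, mem_tuples,
      mem_tuples] at hw
    rw [mem_coe, mem_filter, mem_product, mem_tuples, mem_tuples]
    simp only [Fin.appendEquiv_apply]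
    refine ⟨⟨fun i => ?_, fun i => ?_⟩, ?_⟩
    · refine Fin.addCases (fun i => ?_) (fun i => ?_) i
      · rw [Fin.append_left]; exact hw.1.1.1 i
      · rw [Fin.append_right]; exact hw.1.1.2 i
    · refine Fin.addCases (fun i => ?_) (fun i => ?_) i
      · rw [Fin.append_left]; exact hw.1.2.1 i
      · rw [Fin.append_right]; exact hw.1.2.2 i
    · have happ : ∀ fg : (Fin a → ℤ) × (Fin b → ℤ), (Fin.appendEquiv a b) fg = Fin.append fg.1 fg.2 :=
        fun fg => rfl
      rw [add_zero, happ, happ, psv_append, psv_append]; exact hw.2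
  · intro xy _
    simp only [Equiv.apply_symm_apply]
  · intro w _
    simp only [Equiv.symm_apply_apply]

/-- **Ivić (6.32)**: `J_{a+b,n}(I) ≤ |I|^{2a} J_{b,n}(I)` — fix the first `a` variables on each
side and apply (6.10) to the remaining ones. [cite: Ivic1985, (6.32)] -/
theorem J_add_le (n a b : ℕ) (I : Finset ℤ) : J n (a + b) I ≤ I.card ^ (2 * a) * J n b I := by
  classical
  rw [J_add_eq_card]
  set S := ((tuples a I ×ˢ tuples b I) ×ˢ (tuples a I ×ˢ tuples b I)).filter
      (fun w => psv n w.1.1 + psv n w.1.2 = psv n w.2.1 + psv n w.2.2) with hS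
  have hmaps : Set.MapsTo (fun w : ((Fin a → ℤ) × (Fin b → ℤ)) × ((Fin a → ℤ) × (Fin b → ℤ)) =>
      (w.1.1, w.2.1)) (S : Set _) ((tuples a I ×ˢ tuples a I : Finset _) : Set _) := by
    intro w hw
    rw [hS, mem_coe, mem_filter, mem_product, mem_product, mem_product] at hw
    rw [mem_coe, mem_product]
    exact ⟨hw.1.1.1, hw.1.2.1⟩
  rw [card_eq_sum_card_fiberwise hmaps]
  calc ∑ uu ∈ tuples a I ×ˢ tuples a I, (S.filter (fun w => (w.1.1, w.2.1) = uu)).card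
      ≤ ∑ uu ∈ tuples a I ×ˢ tuples a I, J n b I := by
        refine sum_le_sum fun uu _ => ?_
        refine le_trans ?_ (Jc_le_J n b I (psv n uu.2 - psv n uu.1))
        unfold Jc
        refine card_le_card_of_injOn (fun w => (w.1.2, w.2.2)) ?_ ?_
        · intro w hw
          rw [mem_coe, mem_filter, hS, mem_filter, mem_product, mem_product, mem_product] at hw
          rw [mem_coe, mem_filter, mem_product]
          obtain ⟨⟨⟨⟨_, h12⟩, _, h22⟩, heq⟩, huu⟩ := hw
          refine ⟨⟨h12, h22⟩, ?_⟩
          rw [← huu]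
          simp only
          linear_combination heq
        · intro w hw w' hw' h
          rw [mem_coe, mem_filter] at hw hw'
          simp only [Prod.mk.injEq] at h
          have h1 := hw.2; have h2 := hw'.2
          rw [← h2, Prod.mk.injEq] at h1
          ext <;> simp [h1.1, h1.2, h.1, h.2]
    _ = I.card ^ (2 * a) * J n b I := by
        rw [sum_const, card_product, card_tuples, smul_eq_mul]; ring

/-- The trivial bound `J_{k,n}(I) ≤ |I|^{2k}`. [folklore] -/
theorem J_le_card_pow (n k : ℕ) (I : Finset ℤ) : J n k I ≤ I.card ^ (2 * k) := by
  unfold J Jc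
  refine (card_filter_le _ _).trans (le_of_eq ?_)
  rw [card_product, card_tuples]; ring

end VMV
end Literature.NumberTheory.LFunctions
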